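import Summits.AtomisticToContinuum.FouriersLaw.Theses.EmbeddedDrudeMourre
import Literature.MathematicalPhysics.KineticTheory.PinnedChainResonantFinite

/-!
# FGRGap — negative-side infrastructure: finiteness of resonant sets, monotonicity of the form in
the kernel, and the reduction of the crux to ALS's on-site model

Support lemmas for crux `EmbeddedDrudeMourre.FGRGap` (item stmt-AtomisticToContinuum-12595), from
the standing disprover's work file `Cruxes/FGRGap/Disproof.lean` §5–6 (sorry-free part):

* `boltzmannForm_mono_weight` (uses the landed `PhononBoltzmann.resonantSet_finite` of
  `PinnedChainResonantFinite.lean` off the diagonal of the cell, and the vanishing of the bracket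
  of a periodic `f` on it): `w_{a,b} ≤ C w_{a',b'}` pointwise ⇒ `q_{a,b} ≤ C q_{a',b'}` on
  periodic `f`; `hasOddSectorGap_of_weight_le`: gap transfer.
* `onsite_of_crux`: `FGRGap → ∀ ω₂ > 0, HasOddSectorGap ω₂ 1 0` (the pure on-site gap is a
  NECESSARY condition — `b` is eliminated from any disproof); `crux_on_cone_of_onsite`: the
  on-site family gives the crux back on `0 ≤ 16b < a` (vertex range `a - 16b ≤ Φ ≤ a + 16b`).
-/

noncomputable section

open MeasureTheory Set Real
open scoped ENNReal
open Literature.MathematicalPhysics.KineticTheory.PhononBoltzmann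

namespace Summit.AtomisticToContinuum.FouriersLaw.Theorems.FGRGap.Negative.OnsiteReduction

/-! ## 5. Monotonicity of the form in the collision weight; the vertex is a bounded perturbation -/

/-- **The form is monotone in the weight**: a pointwise bound `w_{a,b} ≤ C · w_{a',b'}` of the
collision kernels gives `q_{a,b}(f) ≤ C · q_{a',b'}(f)` (every `f`). Uses `resonantSet_finite`
off the diagonal of the cell (so that the `finsum`s are finite sums) and the vanishing of the
bracket on it. [folklore] -/
theorem boltzmannForm_mono_weight {ω₂ : ℝ} (hω : 0 < ω₂) {a b a' b' C : ℝ} (hC : 0 ≤ C)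
    (hw : ∀ k₁ k₂ k₃, collisionWeight ω₂ a b k₁ k₂ k₃ ≤ C * collisionWeight ω₂ a' b' k₁ k₂ k₃)
    (f : ℝ → ℝ) :
    boltzmannForm ω₂ a b f ≤ ENNReal.ofReal C * boltzmannForm ω₂ a' b' f := by
  unfold boltzmannForm
  rw [← mul_assoc, mul_comm (ENNReal.ofReal C), mul_assoc]
  gcongr
  rw [← lintegral_const_mul' _ _ ENNReal.ofReal_ne_top]
  apply setLIntegral_mono' measurableSet_Ioc
  intro k₁ hk₁
  rw [← lintegral_const_mul' _ _ ENNReal.ofReal_ne_top]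
  apply setLIntegral_mono' measurableSet_Ioc
  intro k₃ hk₃
  rw [← ENNReal.ofReal_mul hC]
  apply ENNReal.ofReal_le_ofReal
  by_cases hdiag : k₁ = k₃
  · subst hdiag
    simp
  · have hfin := resonantSet_finite hω hk₁ hk₃ hdiag
    rw [finsum_mem_eq_finite_toFinset_sum _ hfin, finsum_mem_eq_finite_toFinset_sum _ hfin,
      Finset.mul_sum]
    apply Finset.sum_le_sum
    intro k₂ _
    calc collisionWeight ω₂ a b k₁ k₂ k₃ * (f k₁ + f k₂ - f k₃ - f (k₁ + k₂ - k₃)) ^ 2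
        ≤ C * collisionWeight ω₂ a' b' k₁ k₂ k₃ * (f k₁ + f k₂ - f k₃ - f (k₁ + k₂ - k₃)) ^ 2 :=
          mul_le_mul_of_nonneg_right (hw k₁ k₂ k₃) (sq_nonneg _)
      _ = _ := by ring

/-- Transfer of a gap constant along `g‖f‖² ≤ q ≤ C q'`. [folklore] -/
theorem gap_transfer {g C : ℝ} (hC : 0 < C) {N q q' : ℝ≥0∞}
    (h1 : ENNReal.ofReal g * N ≤ q) (h2 : q ≤ ENNReal.ofReal C * q') :
    ENNReal.ofReal (g / C) * N ≤ q' := by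
  rw [ENNReal.ofReal_div_of_pos hC, ENNReal.div_eq_inv_mul, mul_assoc,
    ENNReal.inv_mul_le_iff (by simpa using hC) ENNReal.ofReal_ne_top]
  exact h1.trans h2

/-- **Gap transfer between vertices**: if `w_{a',b'} ≤ C w_{a,b}` pointwise (`C > 0`), a gap for
`(a', b')` is inherited… no: a gap for `(a, b)` needs the OTHER direction. Precisely: a gap for
the SMALLER kernel's form passes to the larger one. [folklore] -/
theorem hasOddSectorGap_of_weight_le {ω₂ : ℝ} (hω : 0 < ω₂) {a b a' b' C : ℝ} (hC : 0 < C)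
    (hw : ∀ k₁ k₂ k₃, collisionWeight ω₂ a b k₁ k₂ k₃ ≤ C * collisionWeight ω₂ a' b' k₁ k₂ k₃)
    (h : HasOddSectorGap ω₂ a b) : HasOddSectorGap ω₂ a' b' := by
  obtain ⟨g, hg, h⟩ := h
  refine ⟨g / C, div_pos hg hC, fun f hper hmeas hodd hfin => ?_⟩
  exact gap_transfer hC (h f hper hmeas hodd hfin) (boltzmannForm_mono_weight hω hC.le hw f)

/-- `|∏ sin(k_j/2)| ≤ 1`. [folklore] -/
theorem abs_sin_prod_le_one (k₁ k₂ k₃ : ℝ) :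
    |Real.sin (k₁ / 2) * Real.sin (k₂ / 2) * Real.sin (k₃ / 2) * Real.sin ((k₁ + k₂ - k₃) / 2)| ≤ 1 := by
  rw [abs_mul, abs_mul, abs_mul]
  have h1 := Real.abs_sin_le_one (k₁ / 2)
  have h2 := Real.abs_sin_le_one (k₂ / 2)
  have h3 := Real.abs_sin_le_one (k₃ / 2)
  have h4 := Real.abs_sin_le_one ((k₁ + k₂ - k₃) / 2)
  have h12 : |Real.sin (k₁ / 2)| * |Real.sin (k₂ / 2)| ≤ 1 := mul_le_one₀ h1 (abs_nonneg _) h2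
  have h123 : |Real.sin (k₁ / 2)| * |Real.sin (k₂ / 2)| * |Real.sin (k₃ / 2)| ≤ 1 :=
    mul_le_one₀ h12 (abs_nonneg _) h3
  exact mul_le_one₀ h123 (abs_nonneg _) h4

/-- The vertex is between `a - 16b` and `a + 16b` (`b ≥ 0`). [folklore] -/
theorem vertex_mem_Icc {a b : ℝ} (hb : 0 ≤ b) (k₁ k₂ k₃ : ℝ) :
    vertex a b k₁ k₂ k₃ ∈ Icc (a - 16 * b) (a + 16 * b) := by
  unfold vertex
  have h := abs_le.mp (abs_sin_prod_le_one k₁ k₂ k₃)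
  constructor <;> nlinarith [h.1, h.2]

/-- `Φ_{a,b}² ≤ (a + 16b)²` for `a, b ≥ 0`. [folklore] -/
theorem vertex_sq_le {a b : ℝ} (ha : 0 ≤ a) (hb : 0 ≤ b) (k₁ k₂ k₃ : ℝ) :
    vertex a b k₁ k₂ k₃ ^ 2 ≤ (a + 16 * b) ^ 2 := by
  have h := vertex_mem_Icc hb k₁ k₂ k₃ (a := a)
  apply sq_le_sq'
  · linarith [h.1]
  · exact h.2

/-- `(a - 16b)² ≤ Φ_{a,b}²` on the cone `16b ≤ a`, `b ≥ 0`. [folklore] -/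
theorem le_vertex_sq {a b : ℝ} (hb : 0 ≤ b) (hab : 16 * b ≤ a) (k₁ k₂ k₃ : ℝ) :
    (a - 16 * b) ^ 2 ≤ vertex a b k₁ k₂ k₃ ^ 2 := by
  have h := vertex_mem_Icc hb k₁ k₂ k₃ (a := a)
  exact pow_le_pow_left₀ (by linarith) h.1 2

/-- The couplings enter the kernel only through `Φ²`: `w_{a,b} = Φ_{a,b}² · w_{1,0}`. [folklore] -/
theorem collisionWeight_eq_vertex_sq_mul (ω₂ a b k₁ k₂ k₃ : ℝ) :
    collisionWeight ω₂ a b k₁ k₂ k₃ = vertex a b k₁ k₂ k₃ ^ 2 * collisionWeight ω₂ 1 0 k₁ k₂ k₃ := by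
  unfold collisionWeight
  have hv : vertex 1 0 k₁ k₂ k₃ = 1 := by unfold vertex; ring
  rw [hv]
  ring

/-! ## 6. Reduction of the crux to / from ALS's on-site model `b = 0` -/

/-- **The on-site (ALS, `b = 0`) gap is NECESSARY**: a gap at any `(a, b)` with `a, b ≥ 0`,
`a + 16b > 0` gives the gap of the pure on-site vertex (any `a' > 0`), with constant
`g · (a'/(a+16b))²`. So a disproof may forget `b` altogether: refuting
`∀ ω₂ > 0, HasOddSectorGap ω₂ 1 0` refutes the crux (`onsite_of_crux`). [folklore] -/
theorem hasOddSectorGap_onsite_of_gap {ω₂ a b : ℝ} (hω : 0 < ω₂) (ha : 0 ≤ a) (hb : 0 ≤ b)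
    (hab : 0 < a + 16 * b) (h : HasOddSectorGap ω₂ a b) {a' : ℝ} (ha' : 0 < a') :
    HasOddSectorGap ω₂ a' 0 := by
  refine hasOddSectorGap_of_weight_le hω (C := ((a + 16 * b) / a') ^ 2) (by positivity) ?_ h
  intro k₁ k₂ k₃
  rw [collisionWeight_eq_vertex_sq_mul ω₂ a b, collisionWeight_eq_vertex_sq_mul ω₂ a' 0]
  have hv' : vertex a' 0 k₁ k₂ k₃ = a' := by unfold vertex; ring
  rw [hv', ← mul_assoc]
  apply mul_le_mul_of_nonneg_right _ (collisionWeight_nonneg ω₂ 1 0 k₁ k₂ k₃)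
  calc vertex a b k₁ k₂ k₃ ^ 2 ≤ (a + 16 * b) ^ 2 := vertex_sq_le ha hb k₁ k₂ k₃
    _ = ((a + 16 * b) / a') ^ 2 * a' ^ 2 := by field_simp

/-- **… and SUFFICIENT on the cone `16b < a`**: there `Φ_{a,b} ≥ a - 16b > 0` and the on-site gap
(any `a' > 0`) transfers with constant `g · ((a-16b)/a')²`. (On `a ≤ 16b` this crude comparison
fails; with the sharper range `∏ sin(k_j/2) ≥ -1/4` ON the resonant manifold, claimed numerically
by card grazing-jet-rigidity, the cone would widen to `4b < a`; for `a ≤ 4b` the vertex vanishes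
on a curve of the resonant manifold and no kernel comparison with `b = 0` can work, though the
grazing collisions, where `∏ sin(k_j/2) = sin²(k/2)sin²(k*/2) ≥ 0`, keep `Φ ≥ a`.) [folklore] -/
theorem hasOddSectorGap_of_onsite {ω₂ a' : ℝ} (hω : 0 < ω₂) (ha' : 0 < a')
    (h : HasOddSectorGap ω₂ a' 0) {a b : ℝ} (hb : 0 ≤ b) (hab : 16 * b < a) :
    HasOddSectorGap ω₂ a b := by
  have hpos : 0 < a - 16 * b := by linarith
  refine hasOddSectorGap_of_weight_le hω (C := (a' / (a - 16 * b)) ^ 2) (by positivity) ?_ h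
  intro k₁ k₂ k₃
  rw [collisionWeight_eq_vertex_sq_mul ω₂ a b, collisionWeight_eq_vertex_sq_mul ω₂ a' 0]
  have hv' : vertex a' 0 k₁ k₂ k₃ = a' := by unfold vertex; ring
  rw [hv', ← mul_assoc]
  apply mul_le_mul_of_nonneg_right _ (collisionWeight_nonneg ω₂ 1 0 k₁ k₂ k₃)
  calc a' ^ 2 = (a' / (a - 16 * b)) ^ 2 * (a - 16 * b) ^ 2 := by field_simp
    _ ≤ (a' / (a - 16 * b)) ^ 2 * vertex a b k₁ k₂ k₃ ^ 2 :=
        mul_le_mul_of_nonneg_left (le_vertex_sq hb hab.le k₁ k₂ k₃) (by positivity)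

/-- **Corollary (necessary condition).** The crux implies the odd-sector gap of ALS's on-site
quartic chain (`b = 0`, the model of AokiLukkarinenSpohn2006) at every `ω₂ > 0`. -/
theorem onsite_of_crux (h : Summit.AtomisticToContinuum.FouriersLaw.Theses.EmbeddedDrudeMourre.FGRGap)
    {ω₂ : ℝ} (hω : 0 < ω₂) : HasOddSectorGap ω₂ 1 0 :=
  hasOddSectorGap_onsite_of_gap hω zero_le_one zero_le_one (by norm_num) (h ω₂ 1 1 hω one_pos one_pos)
    one_pos

/-- **Corollary (partial converse).** The on-site gap at every `ω₂ > 0` gives the crux on the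
cone `0 ≤ 16b < a` (in particular the whole `b = 0` slice and all small `b/a`). -/
theorem crux_on_cone_of_onsite (h : ∀ ω₂ : ℝ, 0 < ω₂ → HasOddSectorGap ω₂ 1 0) {ω₂ a b : ℝ}
    (hω : 0 < ω₂) (hb : 0 ≤ b) (hab : 16 * b < a) : HasOddSectorGap ω₂ a b :=
  hasOddSectorGap_of_onsite hω one_pos (h ω₂ hω) hb hab


end Summit.AtomisticToContinuum.FouriersLaw.Theorems.FGRGap.Negative.OnsiteReduction

end
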